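import Mathlib.Analysis.SpecialFunctions.Log.Basic
import HarnessLib

/-!
# K2R refutation, part 5: the abstract contradiction (elimination of the first-moment functional)

Route `EnskogAdjointDuality` of `AtomisticToContinuum/HydrodynamicLimit`, crux K2R
`AdjointEnskogTestFamilyR` (stmt-AtomisticToContinuum-11592), line `refutation` (c5 lead).

The two tested identities of the refutation have the shape, for every cut-off scale `R ≥ 1`,
`|P X − M₀ J Γ| ≤ W₀ + U₀ J` (identity (0): transport `2π/λ` plus delocalisation `π²εA` of the unknown
first-moment functional `X = 𝔎_R` against the second spatial difference of `γ`) and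
`|Q X + S J' Γ| ≤ W₁ + U₁ (J + J')` (identity (I): the `−1/5` contraction pins `X`), where `J = J_R`,
`J' = J'_R` are the logarithmically divergent moments (`|J − J'| ≤ 4`, `J ≥ log R / 25`), `Γ > 0` is the
near-terminal size of `γ` (Step A) and `U₀, U₁` are the un-pinned coefficients, small for large `N`.
Eliminating `X` gives `J (q S Γ − U₀ − 2qU₁) ≤ const`, `q = P/Q`; under the smallness
`U₀ + 2qU₁ ≤ qSΓ/2` this bounds `J_R` uniformly in `R`, contradicting `J_R ≥ log R/25`
(`k2r_ref_fin_abstract`).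
-/

namespace Summit.AtomisticToContinuum.HydrodynamicLimit.Theorems.EnskogAdjointDuality

/-- **The abstract contradiction.** See the module docstring. [folklore] -/
theorem k2r_ref_fin_abstract {P Q M₀ S Γ W₀ W₁ U₀ U₁ : ℝ} (hP : 0 < P) (hQ : 0 < Q) (hM₀ : 0 ≤ M₀)
    (hS : 0 < S) (hΓ : 0 < Γ) (hW₀ : 0 ≤ W₀) (hW₁ : 0 ≤ W₁) (hU₁ : 0 ≤ U₁)
    (hsmall : U₀ + 2 * (P / Q) * U₁ ≤ (P / Q) * S * Γ / 2)
    (h : ∀ R : ℝ, 1 ≤ R → ∃ X J J' : ℝ, 0 ≤ J ∧ 0 ≤ J' ∧ |J - J'| ≤ 4 ∧ Real.log R / 25 ≤ J ∧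
      |P * X - M₀ * J * Γ| ≤ W₀ + U₀ * J ∧ |Q * X + S * J' * Γ| ≤ W₁ + U₁ * (J + J')) : False := by
  set q : ℝ := P / Q with hq
  have hq0 : 0 < q := div_pos hP hQ
  have hqS : 0 < q * S * Γ := by positivity
  -- the uniform bound on `J`
  set B : ℝ := 2 * (4 * q * S * Γ + W₀ + q * W₁ + 4 * q * U₁) / (q * S * Γ) with hB
  have hB0 : 0 ≤ B := by
    rw [hB]; positivity
  have hJle : ∀ R : ℝ, 1 ≤ R → Real.log R / 25 ≤ B := by
    intro R hR
    obtain ⟨X, J, J', hJ, hJ', hJJ, hlog, h0, h1⟩ := h R hR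
    -- multiply (I) by `q` and add (0)
    have h1' : |P * X + q * S * J' * Γ| ≤ q * (W₁ + U₁ * (J + J')) := by
      have : P * X + q * S * J' * Γ = q * (Q * X + S * J' * Γ) := by
        rw [hq]; field_simp
      rw [this, abs_mul, abs_of_pos hq0]
      exact mul_le_mul_of_nonneg_left h1 hq0.le
    have hkey : |M₀ * J * Γ + q * S * J' * Γ| ≤ (W₀ + U₀ * J) + q * (W₁ + U₁ * (J + J')) := by
      have : M₀ * J * Γ + q * S * J' * Γ = (P * X + q * S * J' * Γ) - (P * X - M₀ * J * Γ) := by ring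
      rw [this]
      exact (abs_sub _ _).trans (by linarith)
    have hpos : 0 ≤ M₀ * J * Γ + q * S * J' * Γ := by positivity
    rw [abs_of_nonneg hpos] at hkey
    have hJ'ge : J - 4 ≤ J' := by linarith [(abs_le.1 hJJ).2]
    have hJ'le : J' ≤ J + 4 := by linarith [(abs_le.1 hJJ).1]
    -- `q S Γ (J - 4) ≤ W₀ + U₀ J + q W₁ + q U₁ (2J + 4)`
    have h2 : q * S * Γ * (J - 4) ≤ W₀ + U₀ * J + q * W₁ + q * U₁ * (2 * J + 4) := by
      have hA : q * S * Γ * (J - 4) ≤ q * S * J' * Γ := by nlinarith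
      have hB' : M₀ * J * Γ ≥ 0 := by positivity
      have hC : q * (W₁ + U₁ * (J + J')) ≤ q * W₁ + q * U₁ * (2 * J + 4) := by
        have hqU : 0 ≤ q * U₁ := by positivity
        have : q * (W₁ + U₁ * (J + J')) = q * W₁ + q * U₁ * (J + J') := by ring
        rw [this]
        nlinarith
      linarith
    -- smallness: `U₀ J + 2 q U₁ J ≤ (q S Γ / 2) J`
    have h3 : U₀ * J + q * U₁ * (2 * J) ≤ q * S * Γ / 2 * J := by nlinarith
    have h4 : q * S * Γ / 2 * J ≤ 4 * q * S * Γ + W₀ + q * W₁ + 4 * q * U₁ := by nlinarith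
    have h5 : J ≤ B := by
      rw [hB, le_div_iff₀ hqS]
      nlinarith
    exact hlog.trans h5
  -- choose `R = exp (25 (B + 1))`
  have hR : (1 : ℝ) ≤ Real.exp (25 * (B + 1)) := Real.one_le_exp (by positivity)
  have := hJle _ hR
  rw [Real.log_exp] at this
  linarith

/-- Registered sub-goal `stub_refFinalCore` of the refutation line (keyed theorem of this file): the
abstract contradiction `k2r_ref_fin_abstract`, closed. [folklore] -/
theorem stub_refFinalCore :
    ∀ (P Q M₀ S Γ W₀ W₁ U₀ U₁ : ℝ), 0 < P → 0 < Q → 0 ≤ M₀ → 0 < S → 0 < Γ → 0 ≤ W₀ → 0 ≤ W₁ → 0 ≤ U₁ →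
    U₀ + 2 * (P / Q) * U₁ ≤ (P / Q) * S * Γ / 2 →
    (∀ R : ℝ, 1 ≤ R → ∃ X J J' : ℝ, 0 ≤ J ∧ 0 ≤ J' ∧ |J - J'| ≤ 4 ∧ Real.log R / 25 ≤ J ∧
      |P * X - M₀ * J * Γ| ≤ W₀ + U₀ * J ∧ |Q * X + S * J' * Γ| ≤ W₁ + U₁ * (J + J')) → False :=
  fun _ _ _ _ _ _ _ _ _ hP hQ hM₀ hS hΓ hW₀ hW₁ hU₁ hsmall h =>
    k2r_ref_fin_abstract hP hQ hM₀ hS hΓ hW₀ hW₁ hU₁ hsmall h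

end Summit.AtomisticToContinuum.HydrodynamicLimit.Theorems.EnskogAdjointDuality
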